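import Summits.QuantumFields.BalabanUV.Beta.RemainderExplicitHistoryDiagonalTransport

/-!
# RemainderExplicitHistoryDiagonalLawBeyondHalf — ROAD P3, ORDER-0 PROFILE FAMILY: BEYOND THE INFRARED HALF THE ULTRAVIOLET-END LAW OF
# GENERATION 48 HOLDS AT EVERY CUTOFF — for a pinned family, every infrared distance `m ≥ 1` and every cutoff `n`:
# LOWER (`Wγ < b`, `n ≤ m`): `astar g m − invSq g m n ≥ (1−Wγ∕b)∕(16κ₂(n+m)√(b₂m)) · (Σ_{a<N} ρ(a)min(a,n+m)² − Σ_{a<2n} ρ(a)min(a,n+m)²)` (every `N`);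
# UPPER (`2Wγ < b`): `astar g m − invSq g m n ≤ C_w·(4κ∕((n+m)√(bm)))·Ψ₀ + C_w(C_w∕(1−Wγ∕b))·(4κ∕((n+m)√(b(n+m))))·Ψ₀·M₁∕(2b√b·m√m)` for bounds
# `Ψ₀ ≥ Σ_a ρ(a)min(a,n+m)²` (generation 48's functional) and `M₁ ≥ Σ_a ρ(a)min(a,n)` (`≤ nW`; bounded for a finite first moment): so whenever the
# head `a < 2n` carries at most half of the `min²`-moment the two sides MATCH, `astar g m − invSq g m n ≍ Ψ₀(n+m)∕((n+m)√m)` up to the relative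
# transport correction `C_wM₁∕((1−Wγ∕b)2b√b·m√(n+m))` — generation 48's two-sided law (`n = 0`) extended to every light-headed cutoff, in particular
# well beyond the half, where generation 51's sides `√((n+m)∕2)·τ′(n+m)` and `√m·τ(n+1)` did not meet; §3 transports from TWO positions
# (the ultraviolet end and any `j₁ ≤ j₀`), the seed of a dyadic chain towards the pin (fourth file of station S-d4p3-g52-1)

Cell `pub-balaban`, β-function sub-cell, BINDER row D4 «RemainderConst leaves for Bałaban's split» (`HOME/BINDER-OWNERS.md`; owner lineage
`b2b-balaban-beta-an4`; this file by co-owner #3 lineage `b2b-balaban-beta-d4-p3`, road P3 «the reduction road», generation 52, station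
S-d4p3-g52-1, fourth file; imports the station's third file `RemainderExplicitHistoryDiagonalTransport`), β-FLOW TEAM duty (1); FREEZE (0)
honoured (def-free module in road P3's own `RemainderExplicit*` series; no leaf, no interface, no Literature file).  SOURCE OF THE SHAPES ONLY:
[Balaban1987RG1] (0.20) p. 256, (0.31) and Thm 2 p. 259, §5 p. 298.  [folklore] real analysis about ONE explicit toy family (ours), road P3's
ORDER-0 PROFILE FAMILY `β_{k+1} = b + Σ_{i≤k} ρ(k−i)·min(g_k, |g_k − g_i|)` (generation 44), memory PROFILE `ρ ≥ 0` summable (`Σ_{a<N} ρ_a ≤ W`).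
HONEST FRAMING: *"Discharging BetaPertH makes Bałaban's UV stability UNCONDITIONAL — a real constructive-QFT result; it is NOT the continuum
limit and NOT the Clay problem."*  THIS FILE DISCHARGES NOTHING OF THE KIND; nothing of Bałaban's (1.22) is asserted or constructed; row D4
class UNCHANGED (critical-path width 0; instance 0∕1; D4 DISCHARGE NO DATE); NOT B12 Thm 2, NOT BetaPertH, NOT continuum, NOT Clay.  HONEST
DEPENDENCY: continuum YM on T⁴ ⇐ BetaPertH ∧ nine spine estimates (0/9 proved); BetaPertH ⇐ (D1) ∧ (D4) ∧ CAP+tail; G-an2-4 gates asym, D1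
and NE2/3/4.  ABSOLUTE RULE: nothing is cited as a fact.  All letters NOT-IN-PRINT; `BetaFlowAsPrinted S` records a Markov β_n only.

WHAT IS PROVED ([folklore]; 0 sorry; 0 `def`; pinned family `K ↦ g K` in ]0,γ]; `κ = (b+Wγ)∕b`, `b₂ = 1∕g_IR² + b + Wγ`, `κ₂ = b₂∕b`, `C_w = (1−Wγ∕b)∕(1−2Wγ∕b)`).
* §1 `weight_ge_half_sq` (`2n ≤ min(a,K)` ⇒ `min(a,K)²∕2 ≤ min(a,K)·(min(a,K) − n)`); `sum_weight_ge_minSq_sub_head` (`2n ≤ K` ⇒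
  `(Σ_{a<N} ρ(a)min(a,K)² − Σ_{a<2n} ρ(a)min(a,K)²)∕2 ≤ Σ_{a<N} ρ(a)min(a,K)(min(a,K)−n)₊`); `sum_tail_counts` (`Σ_{c<n} (R(K) − R(c+1)) =
  Σ_{a<K} ρ(a)·min(a,n)` for `n ≤ K`); `feedbackWeight_le_minFirst` (`Σ_{i<n} (R(K−i) − R(n−i))∕((K−i)√(K−i)) ≤ (Σ_{a<K} ρ(a)min(a,n))∕((K−n)√(K−n))`).
* §2 **`astar_sub_invSq_lower_minSq`** (the LOWER display, `n ≤ m`), **`astar_sub_invSq_upper_minSq`** (the UPPER display, every `n`).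
* §3 NEAR THE PIN (pair forms, `2Wγ < b`): `feedbackOn_le` (the feedback over any set of ultraviolet positions against one bound `P`),
  **`disc_upper_transport_two`** (`d_{j₀} ≤ C_w𝒮(j₀) + (C_w∕(1−Wγ∕b))·(d_0·Φ_{[0,j₁)}(j₀) + d_{j₁}·Φ_{[j₁,j₀)}(j₀))` for any `j₁ ≤ j₀ < K` — the third file's
  transport law is `j₁ = 0`; with `K − j₁ = 2(K − j₀)` the seed of a dyadic transport chain towards the pin).
* §4 END **`exists_family_law_everywhere`** (every summable `ρ ≥ 0`, `2Wγ < b`, `g_IR ∈ ]0,γ]`: a pinned family exists, with both laws at every `(m,n)`).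
-/

noncomputable section

open Finset Filter Topology

namespace Summit.QuantumFields.BalabanUV.Beta.RemainderExplicitHistoryDiagonalLawBeyondHalf

open Literature.MathematicalPhysics.QuantumFieldTheory.Balaban1983to89
open Literature.MathematicalPhysics.QuantumFieldTheory.Balaban1983to89.FlowStep
open Literature.MathematicalPhysics.QuantumFieldTheory.Balaban1983to89.T4CouplingMatching
open Literature.MathematicalPhysics.QuantumFieldTheory.Balaban1983to89.T4ContinuumCoupling
open Summit.QuantumFields.BalabanUV.Beta.RemainderExplicitHistoryDiagonalWindow (partialSum_mono)
open Summit.QuantumFields.BalabanUV.Beta.RemainderExplicitHistoryDiagonalTwoRun (invSq_le_invSq_shift_run)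
open Summit.QuantumFields.BalabanUV.Beta.RemainderExplicitHistoryDiagonalComparison (max_disc_le_disc_div)
open Summit.QuantumFields.BalabanUV.Beta.RemainderExplicitHistoryDiagonalRate (cube_half_le)
open Summit.QuantumFields.BalabanUV.Beta.RemainderExplicitHistoryDiagonalLawEverywhere
open Summit.QuantumFields.BalabanUV.Beta.RemainderExplicitHistoryDiagonalTransport

variable {β : HBeta} {b γ W : ℝ} {ρ : ℕ → ℝ}

/-! ## §1 The weight beyond twice the cutoff against generation 48's `min²`; the feedback weight against `Σ_a ρ(a)min(a,n)` -/

/-- Beyond twice the cutoff the new weight is at least half of generation 48's: `2n ≤ min(a,K)` ⇒ `min(a,K)²∕2 ≤ min(a,K)·(min(a,K) − n)`. [folklore] -/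
theorem weight_ge_half_sq {a K n : ℕ} (h : 2 * n ≤ min a K) :
    (min (a : ℝ) K) ^ 2 / 2 ≤ min (a : ℝ) K * ((min a K - n : ℕ) : ℝ) := by
  have hmin_cast : ((min a K : ℕ) : ℝ) = min (a : ℝ) K := Nat.cast_min a K
  have h' : (2 : ℝ) * n ≤ min (a : ℝ) K := by rw [← hmin_cast]; exact_mod_cast h
  have hsub : ((min a K - n : ℕ) : ℝ) = min (a : ℝ) K - n := by
    rw [Nat.cast_sub (by omega), hmin_cast]
  rw [hsub]
  have h0 : (0 : ℝ) ≤ n := Nat.cast_nonneg n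
  nlinarith

/-- **THE WEIGHTED SUM AGAINST `min²` MINUS THE HEAD**: for `2n ≤ K` and every `N`,
`(Σ_{a<N} ρ(a)min(a,K)² − Σ_{a<2n} ρ(a)min(a,K)²)∕2 ≤ Σ_{a<N} ρ(a)·min(a,K)·(min(a,K) − n)₊` — the ages `a ≥ 2n` (where `min(a,K) ≥ 2n`) weigh at least
`min(a,K)²∕2`, the head `a < 2n` is given away. [folklore] -/
theorem sum_weight_ge_minSq_sub_head (hρ0 : ∀ a, 0 ≤ ρ a) {K n : ℕ} (hnK : 2 * n ≤ K) (N : ℕ) :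
    (∑ a ∈ range N, ρ a * (min (a : ℝ) K) ^ 2 - ∑ a ∈ range (2 * n), ρ a * (min (a : ℝ) K) ^ 2) / 2
      ≤ ∑ a ∈ range N, ρ a * (min (a : ℝ) K * ((min a K - n : ℕ) : ℝ)) := by
  have hKpos : (0 : ℝ) ≤ K := Nat.cast_nonneg K
  have hw0 : ∀ a, 0 ≤ ρ a * (min (a : ℝ) K * ((min a K - n : ℕ) : ℝ)) := fun a =>
    mul_nonneg (hρ0 a) (mul_nonneg (le_min (Nat.cast_nonneg a) hKpos) (Nat.cast_nonneg _))
  have hsq0 : ∀ a, 0 ≤ ρ a * (min (a : ℝ) K) ^ 2 := fun a => mul_nonneg (hρ0 a) (sq_nonneg _)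
  by_cases hN : N ≤ 2 * n
  · have h1 : ∑ a ∈ range N, ρ a * (min (a : ℝ) K) ^ 2 ≤ ∑ a ∈ range (2 * n), ρ a * (min (a : ℝ) K) ^ 2 :=
      Finset.sum_le_sum_of_subset_of_nonneg (Finset.range_mono hN) fun a _ _ => hsq0 a
    have h2 : 0 ≤ ∑ a ∈ range N, ρ a * (min (a : ℝ) K * ((min a K - n : ℕ) : ℝ)) := Finset.sum_nonneg fun a _ => hw0 a
    linarith
  rw [not_le] at hN
  rw [← Finset.sum_sdiff (Finset.range_mono hN.le), add_sub_cancel_right]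
  have htail : (∑ a ∈ range N \ range (2 * n), ρ a * (min (a : ℝ) K) ^ 2) / 2
      ≤ ∑ a ∈ range N \ range (2 * n), ρ a * (min (a : ℝ) K * ((min a K - n : ℕ) : ℝ)) := by
    rw [Finset.sum_div]
    refine Finset.sum_le_sum fun a ha => ?_
    have ha' : 2 * n ≤ a := by
      have := (Finset.mem_sdiff.mp ha).2
      rw [Finset.mem_range, not_lt] at this
      exact this
    have hmin : 2 * n ≤ min a K := le_min ha' hnK
    have := weight_ge_half_sq (a := a) (K := K) (n := n) hmin
    calc ρ a * (min (a : ℝ) K) ^ 2 / 2 = ρ a * ((min (a : ℝ) K) ^ 2 / 2) := by ring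
      _ ≤ ρ a * (min (a : ℝ) K * ((min a K - n : ℕ) : ℝ)) := mul_le_mul_of_nonneg_left this (hρ0 a)
  exact htail.trans (Finset.sum_le_sum_of_subset_of_nonneg Finset.sdiff_subset fun a _ _ => hw0 a)

/-- THE ABEL COUNT: for `n ≤ K`, `Σ_{c<n} (R(K) − R(c+1)) = Σ_{a<K} ρ(a)·min(a,n)` — an age `a` lies in `[c+1, K)` for exactly `min(a,n)` of the
`c < n`. [folklore] -/
theorem sum_tail_counts (ρ : ℕ → ℝ) {n K : ℕ} (hnK : n ≤ K) :
    ∑ c ∈ range n, (∑ a ∈ range K, ρ a - ∑ a ∈ range (c + 1), ρ a) = ∑ a ∈ range K, ρ a * (min (a : ℝ) n) := by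
  classical
  have h1 : ∀ c ∈ range n, ∑ a ∈ range K, ρ a - ∑ a ∈ range (c + 1), ρ a = ∑ a ∈ range K, if c + 1 ≤ a then ρ a else 0 := by
    intro c hc
    have hc' := Finset.mem_range.mp hc
    rw [← Finset.sum_filter]
    have hset : (range K).filter (fun a => c + 1 ≤ a) = Ico (c + 1) K := by
      ext a; simp only [Finset.mem_filter, Finset.mem_range, Finset.mem_Ico]; omega
    rw [hset, Finset.sum_Ico_eq_sub _ (by omega : c + 1 ≤ K)]
  rw [Finset.sum_congr rfl h1, Finset.sum_comm]
  refine Finset.sum_congr rfl fun a _ => ?_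
  rw [← Finset.sum_filter]
  have hset : (range n).filter (fun c => c + 1 ≤ a) = range (min a n) := by
    ext c; simp only [Finset.mem_filter, Finset.mem_range, lt_min_iff]; omega
  rw [hset, Finset.sum_const, Finset.card_range, nsmul_eq_mul, Nat.cast_min, mul_comm]

/-- **THE FEEDBACK WEIGHT AGAINST THE PROFILE'S `min(a,n)`-MOMENT** (no tail majorant needed): for `n < K`,
`Σ_{i<n} (R(K−i) − R(n−i))∕((K−i)√(K−i)) ≤ (Σ_{a<K} ρ(a)·min(a,n)) ∕ ((K−n)√(K−n))` — every ultraviolet position `i < n` sits at infrared distance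
`K − i > K − n` and acts through the ages `[n−i, K−i) ⊂ [n−i, K)`; summing `R(K) − R(c)` over `c = n − i ∈ [1, n]` counts each age `a` exactly
`min(a,n)` times (`sum_tail_counts`).  `Σ_{a<K} ρ(a)min(a,n) ≤ nW`, and `≤` the profile's first moment when that is finite. [folklore] -/
theorem feedbackWeight_le_minFirst (hρ0 : ∀ a, 0 ≤ ρ a) {n K : ℕ} (hnK : n < K) :
    ∑ i ∈ range n, (∑ a ∈ range (K - i), ρ a - ∑ a ∈ range (n - i), ρ a) / (((K - i : ℕ) : ℝ) * Real.sqrt ((K - i : ℕ) : ℝ))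
      ≤ (∑ a ∈ range K, ρ a * (min (a : ℝ) n)) / (((K - n : ℕ) : ℝ) * Real.sqrt ((K - n : ℕ) : ℝ)) := by
  have hs0 : (0 : ℝ) < ((K - n : ℕ) : ℝ) := by exact_mod_cast (show 0 < K - n by omega)
  have hD : 0 < ((K - n : ℕ) : ℝ) * Real.sqrt ((K - n : ℕ) : ℝ) := by positivity
  have hterm : ∀ i ∈ range n, (∑ a ∈ range (K - i), ρ a - ∑ a ∈ range (n - i), ρ a)
        / (((K - i : ℕ) : ℝ) * Real.sqrt ((K - i : ℕ) : ℝ))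
      ≤ (∑ a ∈ range K, ρ a - ∑ a ∈ range (n - 1 - i + 1), ρ a) / (((K - n : ℕ) : ℝ) * Real.sqrt ((K - n : ℕ) : ℝ)) := by
    intro i hi
    have hi' := Finset.mem_range.mp hi
    rw [show n - 1 - i + 1 = n - i by omega]
    have hnum0 : 0 ≤ ∑ a ∈ range (K - i), ρ a - ∑ a ∈ range (n - i), ρ a := by
      linarith [partialSum_mono hρ0 (show n - i ≤ K - i by omega)]
    have hnum : ∑ a ∈ range (K - i), ρ a - ∑ a ∈ range (n - i), ρ a ≤ ∑ a ∈ range K, ρ a - ∑ a ∈ range (n - i), ρ a := by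
      linarith [partialSum_mono hρ0 (show K - i ≤ K by omega)]
    have hsi : ((K - n : ℕ) : ℝ) ≤ ((K - i : ℕ) : ℝ) := by exact_mod_cast (show K - n ≤ K - i by omega)
    have hden : ((K - n : ℕ) : ℝ) * Real.sqrt ((K - n : ℕ) : ℝ) ≤ ((K - i : ℕ) : ℝ) * Real.sqrt ((K - i : ℕ) : ℝ) :=
      mul_le_mul hsi (Real.sqrt_le_sqrt hsi) (Real.sqrt_nonneg _) (by positivity)
    exact div_le_div₀ (hnum0.trans hnum) hnum hD hden
  calc _ ≤ ∑ i ∈ range n, (∑ a ∈ range K, ρ a - ∑ a ∈ range (n - 1 - i + 1), ρ a)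
          / (((K - n : ℕ) : ℝ) * Real.sqrt ((K - n : ℕ) : ℝ)) := Finset.sum_le_sum hterm
    _ = (∑ c ∈ range n, (∑ a ∈ range K, ρ a - ∑ a ∈ range (c + 1), ρ a))
          / (((K - n : ℕ) : ℝ) * Real.sqrt ((K - n : ℕ) : ℝ)) := by
        rw [← Finset.sum_div, Finset.sum_range_reflect (fun c => ∑ a ∈ range K, ρ a - ∑ a ∈ range (c + 1), ρ a) n]
    _ = (∑ a ∈ range K, ρ a * (min (a : ℝ) n)) / (((K - n : ℕ) : ℝ) * Real.sqrt ((K - n : ℕ) : ℝ)) := by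
        rw [sum_tail_counts ρ hnK.le]

/-! ## §2 A pinned family: beyond the half, generation 48's functional on both sides -/

/-- **ROAD P3 — BEYOND THE HALF, LOWER SIDE BY GENERATION 48's `min²`-FUNCTIONAL MINUS THE HEAD** (`Wγ < b`).  A family `K ↦ g K` of runs of the
order-0 profile family in ]0,γ] pinned at one `g_IR` (`b > 0`, `γ > 0`, `ρ ≥ 0`, `Σ_{a<N} ρ_a ≤ W`, `Wγ < b`); `b₂ = 1∕g_IR² + (b + Wγ)`, `κ₂ = b₂∕b`.
THEN for every `m ≥ 1`, every cutoff `n ≤ m` (the position `n` lies in the ultraviolet half of the run `n + m`) and every `N`: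
`(1 − Wγ∕b)∕(16κ₂(n+m)√(b₂m))·(Σ_{a<N} ρ(a)min(a,n+m)² − Σ_{a<2n} ρ(a)min(a,n+m)²) ≤ astar g m − invSq g m n`
(the second file's `astar_sub_invSq_lower_everywhere` with `sum_weight_ge_minSq_sub_head`).  At `n = 0` this is generation 48's `le_src` law.
[cite: Balaban1987RG1, (0.20) p.256, (0.31) and Thm 2 p.259] -/
theorem astar_sub_invSq_lower_minSq
    (hβ : ∀ (k : ℕ) (p : Fin (k + 1) → ℝ),
      β k p = b + ∑ i : Fin (k + 1), ρ (k - i) * min (p (Fin.last k)) (|p (Fin.last k) - p i|))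
    (hb : 0 < b) (hγ : 0 < γ) (hρ0 : ∀ a, 0 ≤ ρ a) (hρW : ∀ n, ∑ a ∈ range n, ρ a ≤ W) (hsmall : W * γ < b)
    {g : ℕ → ℕ → ℝ} {gIR : ℝ} (hrun : ∀ K, RGEqH K β (g K)) (hbox : ∀ K i, i ≤ K → 0 < g K i ∧ g K i ≤ γ)
    (hpin : ∀ K, g K K = gIR) {m n : ℕ} (hm : 1 ≤ m) (hnm : n ≤ m) (N : ℕ) :
    (1 - W * γ / b) / (16 * ((1 / gIR ^ 2 + (b + W * γ)) / b) * ((n + m : ℕ) : ℝ)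
          * Real.sqrt ((1 / gIR ^ 2 + (b + W * γ)) * (m : ℝ)))
        * (∑ a ∈ range N, ρ a * (min (a : ℝ) ((n + m : ℕ) : ℝ)) ^ 2
            - ∑ a ∈ range (2 * n), ρ a * (min (a : ℝ) ((n + m : ℕ) : ℝ)) ^ 2)
      ≤ astar g m - invSq g m n := by
  have hW : 0 ≤ W := by simpa using hρW 0
  have hgIR : 0 < gIR := by have := (hbox 0 0 le_rfl).1; rwa [hpin] at this
  have hc : 0 < 1 - W * γ / b := by
    have : W * γ / b < 1 := (div_lt_one hb).mpr hsmall
    linarith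
  have hmpos : (0 : ℝ) < m := by exact_mod_cast hm
  have hKpos : (0 : ℝ) < ((n + m : ℕ) : ℝ) := by exact_mod_cast (show 0 < n + m by omega)
  have h := astar_sub_invSq_lower_everywhere hβ hb hγ hρ0 hρW hsmall hrun hbox hpin hm n N
  have hw := sum_weight_ge_minSq_sub_head (ρ := ρ) hρ0 (K := n + m) (n := n) (by omega) N
  set Y : ℝ := (1 / gIR ^ 2 + (b + W * γ)) / b with hY
  set s : ℝ := Real.sqrt ((1 / gIR ^ 2 + (b + W * γ)) * (m : ℝ)) with hs
  have hY0 : 0 < Y := by rw [hY]; positivity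
  have hs0 : 0 < s := by rw [hs]; positivity
  have e : (1 - W * γ / b) / (16 * Y * ((n + m : ℕ) : ℝ) * s)
      * (∑ a ∈ range N, ρ a * (min (a : ℝ) ((n + m : ℕ) : ℝ)) ^ 2
          - ∑ a ∈ range (2 * n), ρ a * (min (a : ℝ) ((n + m : ℕ) : ℝ)) ^ 2)
      = (1 - W * γ / b) / (8 * Y * ((n + m : ℕ) : ℝ) * s)
        * ((∑ a ∈ range N, ρ a * (min (a : ℝ) ((n + m : ℕ) : ℝ)) ^ 2
          - ∑ a ∈ range (2 * n), ρ a * (min (a : ℝ) ((n + m : ℕ) : ℝ)) ^ 2) / 2) := by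
    ring
  rw [e]
  exact (mul_le_mul_of_nonneg_left hw (by positivity)).trans h

/-- **ROAD P3 — THE UPPER SIDE BY GENERATION 48's `min²`-FUNCTIONAL PLUS THE TRANSPORT CORRECTION, EVERY `(m, n)`** (`2Wγ < b`).  Same pinned family
with `2Wγ < b`; `κ = (b+Wγ)∕b`, `C_w = (1−Wγ∕b)∕(1−2Wγ∕b)`.  IF `Ψ₀ ≥ Σ_{a<N} ρ(a)min(a,n+m)²` and `M₁ ≥ Σ_{a<N} ρ(a)min(a,n)` for all `N`, THEN for `m ≥ 1`:
`astar g m − invSq g m n ≤ C_w·(4κ∕((n+m)√(bm)))·Ψ₀ + C_w·(C_w∕(1−Wγ∕b))·(4κ∕((n+m)√(b(n+m))))·Ψ₀·(1∕(2b√b))·M₁∕(m√m)`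
(the third file's `astar_sub_invSq_upper_transport` with `(min − n)₊ ≤ min` and `feedbackWeight_le_minFirst`).  With the lower law: whenever the head
`a < 2n` carries at most half of `Ψ₀` and `C_wM₁ ≪ (1−Wγ∕b)·2b√b·m√(n+m)`, BOTH SIDES ARE `≍ Ψ₀∕((n+m)√m)`.
[cite: Balaban1987RG1, (0.20) p.256, (0.31) and Thm 2 p.259] -/
theorem astar_sub_invSq_upper_minSq {Ψ₀ M₁ : ℝ}
    (hβ : ∀ (k : ℕ) (p : Fin (k + 1) → ℝ),
      β k p = b + ∑ i : Fin (k + 1), ρ (k - i) * min (p (Fin.last k)) (|p (Fin.last k) - p i|))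
    (hb : 0 < b) (hγ : 0 < γ) (hρ0 : ∀ a, 0 ≤ ρ a) (hρW : ∀ n, ∑ a ∈ range n, ρ a ≤ W) (hsmall2 : 2 * W * γ < b)
    {g : ℕ → ℕ → ℝ} {gIR : ℝ} (hrun : ∀ K, RGEqH K β (g K)) (hbox : ∀ K i, i ≤ K → 0 < g K i ∧ g K i ≤ γ)
    (hpin : ∀ K, g K K = gIR) {m : ℕ} (hm : 1 ≤ m) (n : ℕ)
    (hΨ₀ : ∀ N, ∑ a ∈ range N, ρ a * (min (a : ℝ) ((n + m : ℕ) : ℝ)) ^ 2 ≤ Ψ₀)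
    (hM₁ : ∀ N, ∑ a ∈ range N, ρ a * (min (a : ℝ) n) ≤ M₁) :
    astar g m - invSq g m n
      ≤ (1 - W * γ / b) / (1 - 2 * W * γ / b)
          * (4 * ((b + W * γ) / b) / (((n + m : ℕ) : ℝ) * Real.sqrt (b * (m : ℝ))) * Ψ₀)
        + (1 - W * γ / b) / (1 - 2 * W * γ / b) * ((1 - W * γ / b) / (1 - 2 * W * γ / b) / (1 - W * γ / b))
          * (4 * ((b + W * γ) / b) / (((n + m : ℕ) : ℝ) * Real.sqrt (b * ((n + m : ℕ) : ℝ))) * Ψ₀)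
          * (1 / (2 * b * Real.sqrt b) * (M₁ / ((m : ℝ) * Real.sqrt (m : ℝ)))) := by
  have hW : 0 ≤ W := by simpa using hρW 0
  have hsmall : W * γ < b := by nlinarith
  have hx1 : W * γ / b < 1 := (div_lt_one hb).mpr hsmall
  have hx2 : 2 * W * γ / b < 1 := (div_lt_one hb).mpr hsmall2
  have hc : 0 < 1 - W * γ / b := by linarith
  have hc2 : 0 < 1 - 2 * W * γ / b := by linarith
  have hCw : 0 ≤ (1 - W * γ / b) / (1 - 2 * W * γ / b) := div_nonneg hc.le hc2.le
  have hmpos : (0 : ℝ) < m := by exact_mod_cast hm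
  have hKpos : (0 : ℝ) < ((n + m : ℕ) : ℝ) := by exact_mod_cast (show 0 < n + m by omega)
  have hκ0 : 0 ≤ (b + W * γ) / b := by positivity
  -- `(min − n)₊ ≤ min`, so `Ψ₀` also bounds the weighted sums
  have hΨ : ∀ N, ∑ a ∈ range N, ρ a * (min (a : ℝ) ((n + m : ℕ) : ℝ) * ((min a (n + m) - n : ℕ) : ℝ)) ≤ Ψ₀ := by
    intro N
    refine le_trans (Finset.sum_le_sum fun a _ => mul_le_mul_of_nonneg_left ?_ (hρ0 a)) (hΨ₀ N)
    have h1 : ((min a (n + m) - n : ℕ) : ℝ) ≤ min (a : ℝ) ((n + m : ℕ) : ℝ) := by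
      have : ((min a (n + m) - n : ℕ) : ℝ) ≤ ((min a (n + m) : ℕ) : ℝ) := by exact_mod_cast Nat.sub_le _ _
      rwa [Nat.cast_min] at this
    have h0 : 0 ≤ min (a : ℝ) ((n + m : ℕ) : ℝ) := le_min (Nat.cast_nonneg a) hKpos.le
    rw [sq]
    exact mul_le_mul_of_nonneg_left h1 h0
  have hΨ₀0 : 0 ≤ Ψ₀ := le_trans (by simp) (hΨ₀ 0)
  have h := astar_sub_invSq_upper_transport hβ hb hγ hρ0 hρW hsmall2 hrun hbox hpin hm n hΨ hΨ₀
  -- the feedback weight against `M₁ ∕ (m√m)`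
  have hΦ : ∑ i ∈ range n, (∑ a ∈ range (n + m - i), ρ a - ∑ a ∈ range (n - i), ρ a)
        / (((n + m - i : ℕ) : ℝ) * Real.sqrt ((n + m - i : ℕ) : ℝ))
      ≤ M₁ / ((m : ℝ) * Real.sqrt (m : ℝ)) := by
    have h1 := feedbackWeight_le_minFirst (ρ := ρ) hρ0 (n := n) (K := n + m) (by omega)
    rw [show n + m - n = m by omega] at h1
    refine h1.trans (div_le_div_of_nonneg_right (hM₁ (n + m)) (by positivity))
  have hrest : 0 ≤ (1 - W * γ / b) / (1 - 2 * W * γ / b) * ((1 - W * γ / b) / (1 - 2 * W * γ / b) / (1 - W * γ / b))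
      * (4 * ((b + W * γ) / b) / (((n + m : ℕ) : ℝ) * Real.sqrt (b * ((n + m : ℕ) : ℝ))) * Ψ₀) := by positivity
  refine h.trans (add_le_add le_rfl (mul_le_mul_of_nonneg_left ?_ hrest))
  exact mul_le_mul_of_nonneg_left hΦ (by positivity)

/-! ## §3 Near the pin: the feedback transported from TWO positions (the ultraviolet end and an intermediate `j₁ ≤ j₀`) -/

/-- THE FEEDBACK OVER A SET OF ULTRAVIOLET POSITIONS AGAINST ONE BOUND: two pinned runs of the family in ]0,γ] (A: `K` steps, B: `K + n` steps); if
`d_i ≤ P` for every `i ∈ s ⊆ [0, K)` and `j₀ ≤ K`, then `Σ_{i∈s} ((g^A_i)³∕2)·d_i·(R(K−i) − R(j₀−i)) ≤ P·(1∕(2b√b))·Σ_{i∈s} (R(K−i) − R(j₀−i))∕((K−i)√(K−i))`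
(generation 49's `cube_half_le`; `d_i ≥ 0` by the maximum principle). [cite: Balaban1987RG1, (0.31) p.259] -/
theorem feedbackOn_le
    (hβ : ∀ (k : ℕ) (p : Fin (k + 1) → ℝ),
      β k p = b + ∑ i : Fin (k + 1), ρ (k - i) * min (p (Fin.last k)) (|p (Fin.last k) - p i|))
    (hb : 0 < b) (hγ : 0 < γ) (hρ0 : ∀ a, 0 ≤ ρ a) {K n : ℕ} {gA gB : ℕ → ℝ} (hA : RGEqH K β gA) (hB : RGEqH (K + n) β gB)
    (hAbox : ∀ k, k ≤ K → 0 < gA k ∧ gA k ≤ γ) (hBbox : ∀ k, k ≤ K + n → 0 < gB k ∧ gB k ≤ γ) (hpin : gA K = gB (K + n))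
    {j₀ : ℕ} (hj₀ : j₀ ≤ K) {s : Finset ℕ} (hs : ∀ i ∈ s, i < K) {P : ℝ}
    (hP : ∀ i ∈ s, 1 / (gB (i + n)) ^ 2 - 1 / (gA i) ^ 2 ≤ P) :
    ∑ i ∈ s, (gA i) ^ 3 / 2 * (1 / (gB (i + n)) ^ 2 - 1 / (gA i) ^ 2) * (∑ a ∈ range (K - i), ρ a - ∑ a ∈ range (j₀ - i), ρ a)
      ≤ P * (1 / (2 * b * Real.sqrt b)
          * ∑ i ∈ s, (∑ a ∈ range (K - i), ρ a - ∑ a ∈ range (j₀ - i), ρ a) / (((K - i : ℕ) : ℝ) * Real.sqrt ((K - i : ℕ) : ℝ))) := by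
  have hApos : ∀ k, k ≤ K → 0 < gA k := fun k hk => (hAbox k hk).1
  have hBpos : ∀ k, k ≤ K + n → 0 < gB k := fun k hk => (hBbox k hk).1
  have hlo : BetaLowerH b γ β :=
    RemainderExplicitHistoryHalfMomentWitness.lower (γ := γ) (lam := fun k i => ρ (k - i)) hβ (fun k i => hρ0 _)
  have hdom := invSq_le_invSq_shift_run hβ hb hρ0 hA hB hApos hBpos hpin
  rw [Finset.mul_sum, Finset.mul_sum]
  refine Finset.sum_le_sum fun i hi => ?_
  have hiK : i < K := hs i hi
  have hd0 : 0 ≤ 1 / (gB (i + n)) ^ 2 - 1 / (gA i) ^ 2 := by linarith [hdom i hiK.le]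
  have hw0 : 0 ≤ ∑ a ∈ range (K - i), ρ a - ∑ a ∈ range (j₀ - i), ρ a := by
    linarith [partialSum_mono hρ0 (show j₀ - i ≤ K - i by omega)]
  have hcube := cube_half_le hγ hb hA hAbox hlo hiK
  have hs0 : (0 : ℝ) < ((K - i : ℕ) : ℝ) := by exact_mod_cast (show 0 < K - i by omega)
  calc (gA i) ^ 3 / 2 * (1 / (gB (i + n)) ^ 2 - 1 / (gA i) ^ 2) * (∑ a ∈ range (K - i), ρ a - ∑ a ∈ range (j₀ - i), ρ a)
      ≤ (1 / (2 * b * Real.sqrt b) * (1 / (((K - i : ℕ) : ℝ) * Real.sqrt ((K - i : ℕ) : ℝ)))) * P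
          * (∑ a ∈ range (K - i), ρ a - ∑ a ∈ range (j₀ - i), ρ a) :=
        mul_le_mul_of_nonneg_right (mul_le_mul hcube (hP i hi) hd0 (by positivity)) hw0
    _ = P * (1 / (2 * b * Real.sqrt b) * ((∑ a ∈ range (K - i), ρ a - ∑ a ∈ range (j₀ - i), ρ a)
          / (((K - i : ℕ) : ℝ) * Real.sqrt ((K - i : ℕ) : ℝ)))) := by
        field_simp

/-- **THE UPPER LAW AT EVERY POSITION WITH TWO TRANSPORT SOURCES** (`2Wγ < b`).  Two pinned runs of the order-0 profile family in ]0,γ] (A: `K` steps,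
B: `K + n` steps), `κ`, `C_w` as before; for every `j₁ ≤ j₀ < K`:
`d_{j₀} ≤ C_w·𝒮(j₀) + (C_w∕(1−Wγ∕b))·(d_0·Φ_{[0,j₁)}(j₀) + d_{j₁}·Φ_{[j₁,j₀)}(j₀))`, `Φ_S(j₀) = (1∕(2b√b))·Σ_{i∈S} (R(K−i) − R(j₀−i))∕((K−i)√(K−i))` — the
positions below `j₁` carry `d_i ≤ d_0∕(1−Wγ∕b)`, those in `[j₁, j₀)` carry `d_i ≤ d_{j₁}∕(1−Wγ∕b)` (generation 50's comparison at `0` and at `j₁`).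
With `j₁ = 0` this is the third file's transport law; near the pin choose `K − j₁ = 2(K − j₀)`: the far positions act only through ages `≥ j₀ − j₁ =
K − j₀`, the near ones through `d_{j₁}` at twice the infrared distance — the seed of a dyadic transport chain (census (vi)).
[cite: Balaban1987RG1, (0.20) p.256, (0.31) and Thm 2 p.259] -/
theorem disc_upper_transport_two
    (hβ : ∀ (k : ℕ) (p : Fin (k + 1) → ℝ),
      β k p = b + ∑ i : Fin (k + 1), ρ (k - i) * min (p (Fin.last k)) (|p (Fin.last k) - p i|))
    (hb : 0 < b) (hγ : 0 < γ) (hρ0 : ∀ a, 0 ≤ ρ a) (hρW : ∀ n, ∑ a ∈ range n, ρ a ≤ W) (hsmall2 : 2 * W * γ < b) {K n : ℕ}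
    {gA gB : ℕ → ℝ} (hA : RGEqH K β gA) (hB : RGEqH (K + n) β gB) (hAbox : ∀ k, k ≤ K → 0 < gA k ∧ gA k ≤ γ)
    (hBbox : ∀ k, k ≤ K + n → 0 < gB k ∧ gB k ≤ γ) (hpin : gA K = gB (K + n)) {j₁ j₀ : ℕ} (hj₁ : j₁ ≤ j₀) (hj₀K : j₀ < K) :
    1 / (gB (j₀ + n)) ^ 2 - 1 / (gA j₀) ^ 2
      ≤ (1 - W * γ / b) / (1 - 2 * W * γ / b)
          * (4 * ((b + W * γ) / b) / ((K : ℝ) * Real.sqrt (b * ((K - j₀ : ℕ) : ℝ)))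
            * ∑ a ∈ range (K + n), ρ a * (min (a : ℝ) K * ((min a K - j₀ : ℕ) : ℝ)))
        + (1 - W * γ / b) / (1 - 2 * W * γ / b) / (1 - W * γ / b)
          * ((1 / (gB n) ^ 2 - 1 / (gA 0) ^ 2) * (1 / (2 * b * Real.sqrt b)
              * ∑ i ∈ range j₁, (∑ a ∈ range (K - i), ρ a - ∑ a ∈ range (j₀ - i), ρ a) / (((K - i : ℕ) : ℝ) * Real.sqrt ((K - i : ℕ) : ℝ)))
            + (1 / (gB (j₁ + n)) ^ 2 - 1 / (gA j₁) ^ 2) * (1 / (2 * b * Real.sqrt b)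
              * ∑ i ∈ Ico j₁ j₀, (∑ a ∈ range (K - i), ρ a - ∑ a ∈ range (j₀ - i), ρ a) / (((K - i : ℕ) : ℝ) * Real.sqrt ((K - i : ℕ) : ℝ)))) := by
  have hApos : ∀ k, k ≤ K → 0 < gA k := fun k hk => (hAbox k hk).1
  have hBpos : ∀ k, k ≤ K + n → 0 < gB k := fun k hk => (hBbox k hk).1
  have hW : 0 ≤ W := by simpa using hρW 0
  have hsmall : W * γ < b := by nlinarith
  have hx1 : W * γ / b < 1 := (div_lt_one hb).mpr hsmall
  have hx2 : 2 * W * γ / b < 1 := (div_lt_one hb).mpr hsmall2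
  have hc : 0 < 1 - W * γ / b := by linarith
  have hc2 : 0 < 1 - 2 * W * γ / b := by linarith
  have hCw : 0 ≤ (1 - W * γ / b) / (1 - 2 * W * γ / b) := div_nonneg hc.le hc2.le
  have h := disc_upper_everywhere hβ hb hγ hρ0 hρW hsmall2 hA hB hAbox hBbox hpin hj₀K
  have hmax0 := max_disc_le_disc_div hβ hb hγ hρ0 hρW hsmall hA hB hAbox hBpos hpin 0
  simp only [Nat.zero_add] at hmax0
  have hmax1 := max_disc_le_disc_div hβ hb hγ hρ0 hρW hsmall hA hB hAbox hBpos hpin j₁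
  -- split the feedback at `j₁`
  have hsplit : ∑ i ∈ range j₀, (gA i) ^ 3 / 2 * (1 / (gB (i + n)) ^ 2 - 1 / (gA i) ^ 2)
        * (∑ a ∈ range (K - i), ρ a - ∑ a ∈ range (j₀ - i), ρ a)
      = (∑ i ∈ range j₁, (gA i) ^ 3 / 2 * (1 / (gB (i + n)) ^ 2 - 1 / (gA i) ^ 2)
          * (∑ a ∈ range (K - i), ρ a - ∑ a ∈ range (j₀ - i), ρ a))
        + ∑ i ∈ Ico j₁ j₀, (gA i) ^ 3 / 2 * (1 / (gB (i + n)) ^ 2 - 1 / (gA i) ^ 2)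
          * (∑ a ∈ range (K - i), ρ a - ∑ a ∈ range (j₀ - i), ρ a) := by
    rw [Finset.range_eq_Ico, Finset.range_eq_Ico, ← Finset.sum_Ico_consecutive _ (Nat.zero_le j₁) hj₁]
  have hfar := feedbackOn_le hβ hb hγ hρ0 hA hB hAbox hBbox hpin hj₀K.le (s := range j₁)
    (fun i hi => by have := Finset.mem_range.mp hi; omega)
    (P := (1 / (gB n) ^ 2 - 1 / (gA 0) ^ 2) / (1 - W * γ / b))
    (fun i hi => hmax0 i (Finset.mem_Icc.mpr ⟨Nat.zero_le i, by have := Finset.mem_range.mp hi; omega⟩))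
  have hnear := feedbackOn_le hβ hb hγ hρ0 hA hB hAbox hBbox hpin hj₀K.le (s := Ico j₁ j₀)
    (fun i hi => by have := (Finset.mem_Ico.mp hi).2; omega)
    (P := (1 / (gB (j₁ + n)) ^ 2 - 1 / (gA j₁) ^ 2) / (1 - W * γ / b))
    (fun i hi => hmax1 i (Finset.mem_Icc.mpr ⟨(Finset.mem_Ico.mp hi).1, by have := (Finset.mem_Ico.mp hi).2; omega⟩))
  rw [hsplit] at h
  have key : (∑ i ∈ range j₁, (gA i) ^ 3 / 2 * (1 / (gB (i + n)) ^ 2 - 1 / (gA i) ^ 2)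
          * (∑ a ∈ range (K - i), ρ a - ∑ a ∈ range (j₀ - i), ρ a))
        + ∑ i ∈ Ico j₁ j₀, (gA i) ^ 3 / 2 * (1 / (gB (i + n)) ^ 2 - 1 / (gA i) ^ 2)
          * (∑ a ∈ range (K - i), ρ a - ∑ a ∈ range (j₀ - i), ρ a)
      ≤ 1 / (1 - W * γ / b)
          * ((1 / (gB n) ^ 2 - 1 / (gA 0) ^ 2) * (1 / (2 * b * Real.sqrt b)
              * ∑ i ∈ range j₁, (∑ a ∈ range (K - i), ρ a - ∑ a ∈ range (j₀ - i), ρ a) / (((K - i : ℕ) : ℝ) * Real.sqrt ((K - i : ℕ) : ℝ)))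
            + (1 / (gB (j₁ + n)) ^ 2 - 1 / (gA j₁) ^ 2) * (1 / (2 * b * Real.sqrt b)
              * ∑ i ∈ Ico j₁ j₀, (∑ a ∈ range (K - i), ρ a - ∑ a ∈ range (j₀ - i), ρ a) / (((K - i : ℕ) : ℝ) * Real.sqrt ((K - i : ℕ) : ℝ)))) := by
    have e : ∀ (D Φ : ℝ), D / (1 - W * γ / b) * Φ = 1 / (1 - W * γ / b) * (D * Φ) := fun D Φ => by
      field_simp
    rw [mul_add, ← e, ← e]
    exact add_le_add hfar hnear
  have e2 : (1 - W * γ / b) / (1 - 2 * W * γ / b) / (1 - W * γ / b)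
      = (1 - W * γ / b) / (1 - 2 * W * γ / b) * (1 / (1 - W * γ / b)) := by field_simp
  rw [e2, mul_assoc ((1 - W * γ / b) / (1 - 2 * W * γ / b)) (1 / (1 - W * γ / b)), ← mul_add]
  exact h.trans (mul_le_mul_of_nonneg_left (add_le_add le_rfl key) hCw)

/-! ## §4 END: the laws are not vacuous — a pinned family with the law at every `(m, n)` exists for every summable profile -/

/-- **END — FOR EVERY SUMMABLE PROFILE THE PINNED FAMILIES EXIST AND OBEY THE LAW AT EVERY `(m, n)`** (`2Wγ < b`).  For `ρ ≥ 0` with `Σ_{a<N} ρ(a) ≤ W`,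
`b, γ > 0`, `2Wγ < b` and any `g_IR ∈ ]0,γ]`: there are the order-0 profile family `β` and a family of runs `K ↦ g K` in ]0,γ] pinned at `g_IR`
(generation 47's `runFamily_exists`), and for EVERY `m ≥ 1`, EVERY cutoff `n` and every `N`: the LOWER law of the second file with the exact weight
and the UPPER law of the third file (local weight bound `Ψ`, ultraviolet-end bound `Ψ₀`, transport weight) hold simultaneously.
[cite: Balaban1987RG1, (0.20) p.256, (0.31) and Thm 2 p.259] -/
theorem exists_family_law_everywhere {b γ W gIR : ℝ} (hb : 0 < b) (hγ : 0 < γ) (hρ0 : ∀ a, 0 ≤ ρ a)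
    (hρW : ∀ n, ∑ a ∈ range n, ρ a ≤ W) (hsmall2 : 2 * W * γ < b) (hgIR : 0 < gIR) (hgIRγ : gIR ≤ γ) :
    ∃ (β : HBeta) (g : ℕ → ℕ → ℝ),
      (∀ (k : ℕ) (p : Fin (k + 1) → ℝ),
          β k p = b + ∑ i : Fin (k + 1), ρ (k - i) * min (p (Fin.last k)) (|p (Fin.last k) - p i|))
      ∧ (∀ K, RGEqH K β (g K)) ∧ (∀ K i, i ≤ K → 0 < g K i ∧ g K i ≤ γ) ∧ (∀ K, g K K = gIR)
      ∧ (∀ m n N : ℕ, 1 ≤ m →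
          (1 - W * γ / b) / (8 * ((1 / gIR ^ 2 + (b + W * γ)) / b) * ((n + m : ℕ) : ℝ)
              * Real.sqrt ((1 / gIR ^ 2 + (b + W * γ)) * (m : ℝ)))
            * ∑ a ∈ range N, ρ a * (min (a : ℝ) ((n + m : ℕ) : ℝ) * ((min a (n + m) - n : ℕ) : ℝ))
          ≤ astar g m - invSq g m n)
      ∧ (∀ (m n : ℕ) (Ψ Ψ₀ : ℝ), 1 ≤ m →
          (∀ N, ∑ a ∈ range N, ρ a * (min (a : ℝ) ((n + m : ℕ) : ℝ) * ((min a (n + m) - n : ℕ) : ℝ)) ≤ Ψ) →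
          (∀ N, ∑ a ∈ range N, ρ a * (min (a : ℝ) ((n + m : ℕ) : ℝ)) ^ 2 ≤ Ψ₀) →
          astar g m - invSq g m n
            ≤ (1 - W * γ / b) / (1 - 2 * W * γ / b)
                * (4 * ((b + W * γ) / b) / (((n + m : ℕ) : ℝ) * Real.sqrt (b * (m : ℝ))) * Ψ)
              + (1 - W * γ / b) / (1 - 2 * W * γ / b) * ((1 - W * γ / b) / (1 - 2 * W * γ / b) / (1 - W * γ / b))
                * (4 * ((b + W * γ) / b) / (((n + m : ℕ) : ℝ) * Real.sqrt (b * ((n + m : ℕ) : ℝ))) * Ψ₀)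
                * (1 / (2 * b * Real.sqrt b) * ∑ i ∈ range n,
                    (∑ a ∈ range (n + m - i), ρ a - ∑ a ∈ range (n - i), ρ a)
                      / (((n + m - i : ℕ) : ℝ) * Real.sqrt ((n + m - i : ℕ) : ℝ)))) := by
  let β : HBeta := fun k p => b + ∑ i : Fin (k + 1), ρ (k - i) * min (p (Fin.last k)) (|p (Fin.last k) - p i|)
  have hβ : ∀ (k : ℕ) (p : Fin (k + 1) → ℝ),
      β k p = b + ∑ i : Fin (k + 1), ρ (k - i) * min (p (Fin.last k)) (|p (Fin.last k) - p i|) := fun k p => rfl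
  have hW : 0 ≤ W := by simpa using hρW 0
  have hsmall : W * γ < b := by nlinarith
  obtain ⟨g, hrun, hbox, hpin⟩ :=
    RemainderExplicitHistoryDiagonalProfile.runFamily_exists (W := W) hβ hb hγ hρ0 hρW hsmall2.le hgIR hgIRγ
  refine ⟨β, g, hβ, hrun, hbox, hpin, fun m n N hm => ?_, fun m n Ψ Ψ₀ hm hΨ hΨ₀ => ?_⟩
  · exact astar_sub_invSq_lower_everywhere hβ hb hγ hρ0 hρW hsmall hrun hbox hpin hm n N
  · exact astar_sub_invSq_upper_transport hβ hb hγ hρ0 hρW hsmall2 hrun hbox hpin hm n hΨ hΨ₀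

end Summit.QuantumFields.BalabanUV.Beta.RemainderExplicitHistoryDiagonalLawBeyondHalf

end
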